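import Literature.AlgebraicGeometry.Resolution.LogRegularScheme
import Literature.AlgebraicGeometry.Resolution.EtaleLocalAlgebra
import Literature.AlgebraicGeometry.Resolution.FlatLocalRegularAscent
import Mathlib.AlgebraicGeometry.Morphisms.Etale
import Mathlib.AlgebraicGeometry.Noetherian
import HarnessLib

/-!
# Logarithmic regularity is local for flat local homomorphisms with trivial closed fibre, in
# particular étale-local (Kato 1994, Def. (2.1); Nizioł 2006, Def. 2.2 / Lemma 2.3)

Topic: `Literature/AlgebraicGeometry/Resolution`. Block EK-1 of the ÉTALE KATO programme of cell
res-hironaka (res-type-037, `ETALE-KATO-SPEC.md` v1: «LOG REGULARITY IS ÉTALE-LOCAL»), the input of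
the étale-links step towards the named fact `Niziol2006_logRegularScheme_hasResolution`
(`LogRegularSchemeEtale.lean`). Kato's condition (2.1) for one chart `φ : P → (R, ·)` through a local
ring (`LogChart.IsLogRegularLocal`: `R/I` regular and `dim R = dim R/I + (n − rk Fᵍᵖ)`, `I` = Kato's ideal
`nonunitIdeal`, `F` = the face of units `unitFace`) is read in the local rings of an étale log scheme
(Nizioł 2006, Def. 2.2: «`(X, M_X)` is log regular at `x` if … `𝒪_{X,x̄}/I_{x̄}` is regular and
`dim 𝒪_{X,x̄} = dim 𝒪_{X,x̄}/I_{x̄} + rank (M^gp_{x̄}/𝒪^×)`», strict local rings; Lemma 2.3: for Zariski log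
structures this agrees with Kato's definition). What makes the definition independent of the étale
neighbourhood is the following piece of local algebra, PROVED here:

* `LogChart.unitFace_comp_of_isLocalHom`, `LogChart.nonunitIdeal_comp_of_isLocalHom` — along a LOCAL
  homomorphism `ψ : R → S` the face of units of `ψ ∘ φ` is that of `φ` and Kato's ideal is extended:
  `I(ψ ∘ φ) = I(φ)·S`;
* `ringKrullDim_eq_of_flat_of_map_maximalIdeal_eq`, `isRegularLocalRing_iff_of_flat_of_map_maximalIdeal_eq`
  — for a FLAT local homomorphism `A → B` of Noetherian local rings with `𝔪_A B = 𝔪_B`: `dim B = dim A`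
  (Matsumura Thm. 15.1) and `B` regular ⟺ `A` regular (Thm. 23.7); the same for the quotients
  `A/I → B/IB` (`map_maximalIdeal_quotientMap_eq`);
* **`LogChart.isLogRegularLocal_comp_algebraMap_iff`** — hence **`IsLogRegularLocal P (B ∘ φ) ⟺
  IsLogRegularLocal P φ`** for such `A → B`; **`LogChart.isLogRegularLocal_comp_iff_of_etaleLocal`** —
  in particular for an étale-local homomorphism (flat, formally unramified, essentially of finite
  type: `𝔪_A B = 𝔪_B` by Mathlib `Algebra.FormallyUnramified.map_maximalIdeal`);
* **`LogChart.isLogRegularLocal_comp_stalkMap_iff`** — scheme form: for `f : X' ⟶ X` flat, unramified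
  and locally of finite type (e.g. étale) between locally Noetherian schemes and a chart `φ` through
  `𝒪_{X, f x'}`, the chart `f^♯_{x'} ∘ φ` through `𝒪_{X', x'}` is log regular iff `φ` is.

No definitions and no named facts are introduced. AI-written; AI review is weaker than expert review.

## Sources

* K. Kato, *Toric singularities*, Amer. J. Math. 116 (1994), Def. (2.1). [Kato1994]
* W. Nizioł, *Toric singularities: log-blow-ups and global resolutions*, J. Algebraic Geom. 15 (2006),
  Def. 2.2, Lemma 2.3. [Niziol2006]
* H. Matsumura, *Commutative Ring Theory* (1986), Thm. 15.1, Thm. 23.7. [Matsumura1987]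
* The Stacks Project, Tag 00UW (unramified local algebras: `𝔪_A B = 𝔪_B`). [StacksProject]
-/

noncomputable section

open IsLocalRing AlgebraicGeometry CategoryTheory

namespace Literature.AlgebraicGeometry.Resolution

universe u

/-! ## 1. Face of units and Kato's ideal along a local homomorphism -/

namespace LogChart

variable {n : ℕ} {R S : Type u} [CommRing R] [CommRing S]

/-- The face of units of a chart is unchanged by composing with a LOCAL homomorphism (units are
detected downstairs). [cite: Kato1994, Def. (2.1)] -/
theorem unitFace_comp_of_isLocalHom (P : AddSubmonoid (Fin n → ℤ)) (φ : Multiplicative P →* R)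
    (ψ : R →+* S) [IsLocalHom ψ] : unitFace P (ψ.toMonoidHom.comp φ) = unitFace P φ := by
  ext p
  simp only [mem_unitFace_iff, MonoidHom.coe_comp, Function.comp_apply, RingHom.toMonoidHom_eq_coe,
    MonoidHom.coe_coe]
  exact isUnit_map_iff ψ _

/-- Kato's ideal of the composite chart `ψ ∘ φ` along a local homomorphism `ψ` is the extension
`I(φ)·S` of Kato's ideal of `φ`. [cite: Kato1994, Def. (2.1)] [cite: Niziol2006, Def. 2.2] -/
theorem nonunitIdeal_comp_of_isLocalHom (P : AddSubmonoid (Fin n → ℤ)) (φ : Multiplicative P →* R)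
    (ψ : R →+* S) [IsLocalHom ψ] :
    nonunitIdeal P (ψ.toMonoidHom.comp φ) = (nonunitIdeal P φ).map ψ := by
  rw [nonunitIdeal, nonunitIdeal, Ideal.map_span, ← Set.image_comp]
  congr 1
  ext y
  simp only [Set.mem_image, Set.mem_setOf_eq, MonoidHom.coe_comp, Function.comp_apply,
    RingHom.toMonoidHom_eq_coe, MonoidHom.coe_coe]
  constructor
  · rintro ⟨p, hp, rfl⟩
    exact ⟨p, fun h => hp ((isUnit_map_iff ψ _).2 h), rfl⟩
  · rintro ⟨p, hp, rfl⟩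
    exact ⟨p, fun h => hp ((isUnit_map_iff ψ _).1 h), rfl⟩

/-- Kato's ideal is a proper ideal of a local ring. [cite: Kato1994, Def. (2.1)] -/
theorem nonunitIdeal_ne_top [IsLocalRing R] (P : AddSubmonoid (Fin n → ℤ))
    (φ : Multiplicative P →* R) : nonunitIdeal P φ ≠ ⊤ := fun h =>
  (maximalIdeal.isMaximal R).ne_top (top_le_iff.mp (h ▸ nonunitIdeal_le_maximalIdeal P φ))

end LogChart

/-! ## 2. Flat local homomorphisms with trivial closed fibre -/

section FlatTrivialFibre

variable (A B : Type u) [CommRing A] [CommRing B] [Algebra A B] [IsLocalRing A] [IsLocalRing B]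
  [IsLocalHom (algebraMap A B)]

/-- **`dim B = dim A`** for a flat local homomorphism of Noetherian local rings with `𝔪_A B = 𝔪_B`
(dimension formula, Matsumura Thm. 15.1: `dim B = dim A + dim B/𝔪_A B`). [cite: Matsumura1987, Thm. 15.1] -/
theorem ringKrullDim_eq_of_flat_of_map_maximalIdeal_eq [IsNoetherianRing A] [IsNoetherianRing B]
    [Module.Flat A B] (h : (maximalIdeal A).map (algebraMap A B) = maximalIdeal B) :
    ringKrullDim B = ringKrullDim A := by
  have h' := Ideal.height_eq_height_add_of_liesOver_of_hasGoingDown (maximalIdeal A) (maximalIdeal B)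
  rw [h, Ideal.map_quotient_self, Ideal.height_bot, add_zero] at h'
  rw [← IsLocalRing.maximalIdeal_height_eq_ringKrullDim,
    ← IsLocalRing.maximalIdeal_height_eq_ringKrullDim, h']

/-- **Regularity is invariant** along a flat local homomorphism of Noetherian local rings with
`𝔪_A B = 𝔪_B` (descent: Matsumura 23.7 (i); ascent: 23.7 (ii) with trivial fibre,
`IsRegularLocalRing.of_flat_of_map_maximalIdeal_eq`). [cite: Matsumura1987, Thm. 23.7] -/
theorem isRegularLocalRing_iff_of_flat_of_map_maximalIdeal_eq [IsNoetherianRing A] [IsNoetherianRing B]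
    [Module.Flat A B] (h : (maximalIdeal A).map (algebraMap A B) = maximalIdeal B) :
    IsRegularLocalRing B ↔ IsRegularLocalRing A :=
  ⟨fun _ => IsRegularLocalRing.of_flat_of_isLocalHom A B,
    fun _ => IsRegularLocalRing.of_flat_of_map_maximalIdeal_eq A B h⟩

variable {A B}

omit [IsLocalHom (algebraMap A B)] in
/-- The quotient homomorphism `A/I → B/IB` again has trivial closed fibre:
`𝔪_{A/I}·(B/IB) = 𝔪_{B/IB}` when `𝔪_A B = 𝔪_B`. [cite: Matsumura1987, Thm. 23.7] -/
theorem map_maximalIdeal_quotientMap_eq (h : (maximalIdeal A).map (algebraMap A B) = maximalIdeal B)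
    (I : Ideal A) [Nontrivial (A ⧸ I)] [Nontrivial (B ⧸ I.map (algebraMap A B))] :
    haveI := IsLocalRing.of_surjective' (Ideal.Quotient.mk I) Ideal.Quotient.mk_surjective
    haveI := IsLocalRing.of_surjective' (Ideal.Quotient.mk (I.map (algebraMap A B)))
      Ideal.Quotient.mk_surjective
    (maximalIdeal (A ⧸ I)).map (algebraMap (A ⧸ I) (B ⧸ I.map (algebraMap A B))) =
      maximalIdeal (B ⧸ I.map (algebraMap A B)) := by
  haveI := IsLocalRing.of_surjective' (Ideal.Quotient.mk I) Ideal.Quotient.mk_surjective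
  haveI := IsLocalRing.of_surjective' (Ideal.Quotient.mk (I.map (algebraMap A B)))
    Ideal.Quotient.mk_surjective
  rw [← IsLocalRing.map_maximalIdeal_of_surjective (Ideal.Quotient.mk I) Ideal.Quotient.mk_surjective,
    ← IsLocalRing.map_maximalIdeal_of_surjective (Ideal.Quotient.mk (I.map (algebraMap A B)))
      Ideal.Quotient.mk_surjective, Ideal.map_map, ← h, Ideal.map_map]
  congr 1

end FlatTrivialFibre

/-! ## 3. Log regularity along flat local homomorphisms with trivial closed fibre -/

namespace LogChart

variable {n : ℕ} (A B : Type u) [CommRing A] [CommRing B] [Algebra A B] [IsLocalRing A]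
  [IsLocalRing B] [IsLocalHom (algebraMap A B)] [IsNoetherianRing A] [IsNoetherianRing B]

/-- **Kato's (2.1) is invariant along a flat local homomorphism with `𝔪_A B = 𝔪_B`.** For a chart
`φ : P → (A, ·)` and such `A → B` (Noetherian local rings): `B ∘ φ` is log regular iff `φ` is. With
`I = I(φ)`: `I(B ∘ φ) = IB`, the faces of units agree, `A/I → B/IB` is again flat local with trivial
closed fibre, so `B/IB` is regular iff `A/I` is and `dim B/IB = dim A/I`, `dim B = dim A`.
[cite: Kato1994, Def. (2.1)] [cite: Niziol2006, Def. 2.2, Lemma 2.3] [cite: Matsumura1987, Thm. 23.7] -/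
theorem isLogRegularLocal_comp_algebraMap_iff [Module.Flat A B]
    (h : (maximalIdeal A).map (algebraMap A B) = maximalIdeal B)
    (P : AddSubmonoid (Fin n → ℤ)) (φ : Multiplicative P →* A) :
    IsLogRegularLocal P ((algebraMap A B).toMonoidHom.comp φ) ↔ IsLogRegularLocal P φ := by
  set I : Ideal A := nonunitIdeal P φ with hI
  have hIB : nonunitIdeal P ((algebraMap A B).toMonoidHom.comp φ) = I.map (algebraMap A B) :=
    nonunitIdeal_comp_of_isLocalHom P φ (algebraMap A B)
  have hItop : I ≠ ⊤ := nonunitIdeal_ne_top P φ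
  have hIBtop : I.map (algebraMap A B) ≠ ⊤ := by
    rw [← hIB]
    exact nonunitIdeal_ne_top P _
  haveI : Nontrivial (A ⧸ I) := Ideal.Quotient.nontrivial_iff.mpr hItop
  haveI : Nontrivial (B ⧸ I.map (algebraMap A B)) := Ideal.Quotient.nontrivial_iff.mpr hIBtop
  haveI hlA := IsLocalRing.of_surjective' (Ideal.Quotient.mk I) Ideal.Quotient.mk_surjective
  haveI hlB := IsLocalRing.of_surjective' (Ideal.Quotient.mk (I.map (algebraMap A B)))
    Ideal.Quotient.mk_surjective
  haveI : IsLocalHom (algebraMap (A ⧸ I) (B ⧸ I.map (algebraMap A B))) :=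
    isLocalHom_quotient_map I
  haveI : Module.Flat (A ⧸ I) (B ⧸ I.map (algebraMap A B)) :=
    Module.Flat.of_linearEquiv
      (Algebra.TensorProduct.quotIdealMapEquivQuotTensor B I).toLinearEquiv
  have hq : (maximalIdeal (A ⧸ I)).map (algebraMap (A ⧸ I) (B ⧸ I.map (algebraMap A B))) =
      maximalIdeal (B ⧸ I.map (algebraMap A B)) := map_maximalIdeal_quotientMap_eq h I
  have hdimq : ringKrullDim (B ⧸ I.map (algebraMap A B)) = ringKrullDim (A ⧸ I) :=
    ringKrullDim_eq_of_flat_of_map_maximalIdeal_eq (A ⧸ I) (B ⧸ I.map (algebraMap A B)) hq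
  have hregq : IsRegularLocalRing (B ⧸ I.map (algebraMap A B)) ↔ IsRegularLocalRing (A ⧸ I) :=
    isRegularLocalRing_iff_of_flat_of_map_maximalIdeal_eq (A ⧸ I) (B ⧸ I.map (algebraMap A B)) hq
  have hdim : ringKrullDim B = ringKrullDim A := ringKrullDim_eq_of_flat_of_map_maximalIdeal_eq A B h
  have hface : unitFace P ((algebraMap A B).toMonoidHom.comp φ) = unitFace P φ :=
    unitFace_comp_of_isLocalHom P φ (algebraMap A B)
  unfold IsLogRegularLocal
  rw [hIB, hface, hdim, hdimq, hregq]

/-- **Kato's (2.1) is étale-local**: for a flat, formally unramified, essentially finite-type local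
homomorphism `A → B` of Noetherian local rings (the stalk map of an étale morphism; `𝔪_A B = 𝔪_B`,
Stacks 00UW) a chart `φ` through `A` is log regular iff `B ∘ φ` is. [cite: Niziol2006, Def. 2.2, Lemma 2.3]
[cite: Kato1994, Def. (2.1)] [cite: StacksProject, Tag 00UW] -/
theorem isLogRegularLocal_comp_iff_of_etaleLocal [Module.Flat A B] [Algebra.EssFiniteType A B]
    [Algebra.FormallyUnramified A B] (P : AddSubmonoid (Fin n → ℤ)) (φ : Multiplicative P →* A) :
    IsLogRegularLocal P ((algebraMap A B).toMonoidHom.comp φ) ↔ IsLogRegularLocal P φ :=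
  isLogRegularLocal_comp_algebraMap_iff A B (Algebra.FormallyUnramified.map_maximalIdeal) P φ

end LogChart

/-! ## 4. Scheme form: along an étale morphism -/

section Scheme

variable {X' X : Scheme.{u}} (f : X' ⟶ X) [FormallyUnramified f] [LocallyOfFiniteType f] [Flat f]

/-- **Log regularity of a chart at a point is unchanged along an étale morphism**: for `f : X' ⟶ X`
flat, unramified and locally of finite type between locally Noetherian schemes, `x' ∈ X'` and a chart
`φ : P → (𝒪_{X, f x'}, ·)`, the chart `f^♯_{x'} ∘ φ` through `𝒪_{X', x'}` satisfies Kato's (2.1) iff `φ`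
does (the stalk map is flat, unramified and essentially of finite type). [cite: Niziol2006, Def. 2.2, Lemma 2.3]
[cite: Kato1994, Def. (2.1)] -/
theorem LogChart.isLogRegularLocal_comp_stalkMap_iff [IsLocallyNoetherian X] [IsLocallyNoetherian X']
    (x' : X') {n : ℕ} (P : AddSubmonoid (Fin n → ℤ))
    (φ : Multiplicative P →* (X.presheaf.stalk (f x') : Type u)) :
    LogChart.IsLogRegularLocal P ((f.stalkMap x').hom.toMonoidHom.comp φ) ↔
      LogChart.IsLogRegularLocal P φ := by
  algebraize [(f.stalkMap x').hom]
  haveI : IsLocalHom (algebraMap (X.presheaf.stalk (f x')) (X'.presheaf.stalk x')) :=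
    inferInstanceAs <| IsLocalHom (f.stalkMap x').hom
  haveI : Module.Flat (X.presheaf.stalk (f x')) (X'.presheaf.stalk x') := Flat.stalkMap f x'
  haveI : Algebra.EssFiniteType (X.presheaf.stalk (f x')) (X'.presheaf.stalk x') := by
    rw [← RingHom.essFiniteType_algebraMap, RingHom.algebraMap_toAlgebra]
    exact LocallyOfFiniteType.stalkMap f x'
  haveI : Algebra.FormallyUnramified (X.presheaf.stalk (f x')) (X'.presheaf.stalk x') := by
    rw [← RingHom.formallyUnramified_algebraMap, RingHom.algebraMap_toAlgebra]
    exact FormallyUnramified.stalkMap f x'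
  exact LogChart.isLogRegularLocal_comp_iff_of_etaleLocal (X.presheaf.stalk (f x'))
    (X'.presheaf.stalk x') P φ

end Scheme

end Literature.AlgebraicGeometry.Resolution

end
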